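import Summits.MatrixMultiplication.MatrixMultiplication.Theorems.AbelianSTPPCensusTECertKnapsack

/-!
# Certificate checker for `ShapeExclusionTE`: search states of sub-families (filters O3, break test, residual test)

Cell mm-stpp, route `AbelianSTPPCensus`, crux `ShapeExclusionTE` (stmt-MatrixMultiplication-19759); see the module docstring of
`AbelianSTPPCensusTECertDefs.lean` for the design of the certificate checker.  Support file (no new definitions).

Content: the state `stOf M H` of a sub-family `H ≤ F` of a family `F` satisfying `AdmM M F` passes the node filter
(`okSt_stOf`: U2, U11 per member through running minima, sharpened U14 via `c ≤ gcd(V,M)`), its remaining members are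
volume-eligible (`eligible_of_mem`), their total weight is bounded by `budget` (`weight_le_budget`), so a dominating
row refutes «beats» when the break test fires (`not_break`); the residual test certifies `ResidualM`
(`residual_of_resid`).
-/

-- single-conjunct summit: the mandated namespace repeats `MatrixMultiplication`.
set_option linter.dupNamespace false

namespace Summit.MatrixMultiplication.MatrixMultiplication.Theorems.TECert

/-! ## State semantics -/

section StateLemmas

variable (M : ℕ)

/-- State of the empty family. -/
@[simp] theorem stOf_nil : stOf M [] = emptySt M := rfl

/-- State after adding a member. -/
@[simp] theorem stOf_cons (t : ℕ × ℕ × ℕ) (H : List (ℕ × ℕ × ℕ)) :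
    stOf M (t :: H) = upd (stOf M H) (mkRec M t.1 t.2.1 t.2.2) := rfl

/-- The state field `P` is `Σ ab`. -/
theorem stOf_P (H : List (ℕ × ℕ × ℕ)) : (stOf M H).P = (H.map uu).sum := by
  induction H with
  | nil => rfl
  | cons t H ih => simp [upd, ih, uu, mkRec]; ring

/-- The state field `Q` is `Σ bc`. -/
theorem stOf_Q (H : List (ℕ × ℕ × ℕ)) : (stOf M H).Q = (H.map vv).sum := by
  induction H with
  | nil => rfl
  | cons t H ih => simp [upd, ih, vv, mkRec]; ring

/-- The state field `R` is `Σ ca`. -/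
theorem stOf_R (H : List (ℕ × ℕ × ℕ)) : (stOf M H).R = (H.map ww).sum := by
  induction H with
  | nil => rfl
  | cons t H ih => simp [upd, ih, ww, mkRec]; ring

/-- The state field `sq` is `Σ qOf V`. -/
theorem stOf_sq (H : List (ℕ × ℕ × ℕ)) : (stOf M H).sq = (H.map fun t => qOf (vol t)).sum := by
  induction H with
  | nil => rfl
  | cons t H ih => simp [upd, ih, vol, mkRec]; ring

/-- The state field `fam` is the member list. -/
theorem stOf_fam (H : List (ℕ × ℕ × ℕ)) : (stOf M H).fam = H := by
  induction H with
  | nil => rfl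
  | cons t H ih => simp [upd, ih, mkRec]

end StateLemmas

/-! ## Consequences of `AdmM` for sub-families -/

section AdmLemmas

variable {M : ℕ} {F : Multiset (ℕ × ℕ × ℕ)}

/-- `sumP` of a list. -/
theorem sumP_coe (H : List (ℕ × ℕ × ℕ)) : sumP (H : Multiset (ℕ × ℕ × ℕ)) = (H.map uu).sum := by
  simp [sumP]
/-- `sumQ` of a list. -/
theorem sumQ_coe (H : List (ℕ × ℕ × ℕ)) : sumQ (H : Multiset (ℕ × ℕ × ℕ)) = (H.map vv).sum := by
  simp [sumQ]
/-- `sumR` of a list. -/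
theorem sumR_coe (H : List (ℕ × ℕ × ℕ)) : sumR (H : Multiset (ℕ × ℕ × ℕ)) = (H.map ww).sum := by
  simp [sumR]
/-- `sumVal` of a list. -/
theorem sumVal_coe (H : List (ℕ × ℕ × ℕ)) :
    sumVal (H : Multiset (ℕ × ℕ × ℕ)) = (H.map fun t => qOf (vol t)).sum := by
  simp [sumVal]

/-- `sumP` is additive. -/
theorem sumP_add (s t : Multiset (ℕ × ℕ × ℕ)) : sumP (s + t) = sumP s + sumP t := by simp [sumP]
/-- `sumQ` is additive. -/
theorem sumQ_add (s t : Multiset (ℕ × ℕ × ℕ)) : sumQ (s + t) = sumQ s + sumQ t := by simp [sumQ]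
/-- `sumR` is additive. -/
theorem sumR_add (s t : Multiset (ℕ × ℕ × ℕ)) : sumR (s + t) = sumR s + sumR t := by simp [sumR]
/-- `sumVal` is additive. -/
theorem sumVal_add (s t : Multiset (ℕ × ℕ × ℕ)) : sumVal (s + t) = sumVal s + sumVal t := by simp [sumVal]

/-- decomposition of the family along a sub-family -/
theorem decomp {H : List (ℕ × ℕ × ℕ)} (hH : (H : Multiset (ℕ × ℕ × ℕ)) ≤ F) :
    F = (H : Multiset (ℕ × ℕ × ℕ)) + (F - (H : Multiset (ℕ × ℕ × ℕ))) := (add_tsub_cancel_of_le hH).symm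

/-- `notLe f g` is the indicator of `¬ f ≤ g`. -/
theorem notLe_eq (f g : ℕ) : notLe f g = if f ≤ g then 0 else 1 := by
  unfold notLe; split_ifs <;> omega

/-- sharpened U14 offset of a member against the full sums -/
theorem dab_add_le (hA : AdmM M F) {t : ℕ × ℕ × ℕ} (ht : t ∈ F) :
    (mkRec M t.1 t.2.1 t.2.2).dab + sumP F ≤ M ∧ (mkRec M t.1 t.2.1 t.2.2).dbc + sumQ F ≤ M ∧
      (mkRec M t.1 t.2.1 t.2.2).dca + sumR F ≤ M := by
  obtain ⟨htab, -, -, h14⟩ := hA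
  obtain ⟨h1, h2, h3, -⟩ := htab t ht
  obtain ⟨⟨hab, habt⟩, ⟨hbc, hbct⟩, ⟨hca, hcat⟩⟩ := h14 t ht
  have hV : 1 ≤ vol t := vol_pos h1 h2 h3
  have hg : 0 < Nat.gcd (vol t) M := Nat.gcd_pos_of_pos_left _ hV
  -- a tight rotation forces the free size below the gcd
  have key : ∀ f : ℕ, (∃ d, f ≤ d ∧ d ∣ vol t ∧ d ∣ M) → f ≤ Nat.gcd (vol t) M := by
    rintro f ⟨d, hfd, hdV, hdM⟩
    exact hfd.trans (Nat.le_of_dvd hg (Nat.dvd_gcd hdV hdM))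
  have huu : uu t ≤ vol t := by
    unfold uu vol; calc t.1 * t.2.1 = t.1 * t.2.1 * 1 := by ring
      _ ≤ t.1 * t.2.1 * t.2.2 := Nat.mul_le_mul le_rfl h3
  have hvv : vv t ≤ vol t := by
    unfold vv vol; calc t.2.1 * t.2.2 = 1 * (t.2.1 * t.2.2) := by ring
      _ ≤ t.1 * (t.2.1 * t.2.2) := Nat.mul_le_mul h1 le_rfl
      _ = t.1 * t.2.1 * t.2.2 := by ring
  have hww : ww t ≤ vol t := by
    unfold ww vol; calc t.2.2 * t.1 = t.1 * 1 * t.2.2 := by ring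
      _ ≤ t.1 * t.2.1 * t.2.2 := Nat.mul_le_mul (Nat.mul_le_mul le_rfl h2) le_rfl
  simp only [mkRec, notLe_eq]
  refine ⟨?_, ?_, ?_⟩
  · split_ifs with hc
    · change vol t - uu t + 0 + sumP F ≤ M; omega
    · change vol t - uu t + 1 + sumP F ≤ M
      have : vol t + sumP F ≠ M + uu t := fun h => hc (key _ (habt h))
      omega
  · split_ifs with hc
    · change vol t - vv t + 0 + sumQ F ≤ M; omega
    · change vol t - vv t + 1 + sumQ F ≤ M
      have : vol t + sumQ F ≠ M + vv t := fun h => hc (key _ (hbct h))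
      omega
  · split_ifs with hc
    · change vol t - ww t + 0 + sumR F ≤ M; omega
    · change vol t - ww t + 1 + sumR F ≤ M
      have : vol t + sumR F ≠ M + ww t := fun h => hc (key _ (hcat h))
      omega

/-- the running maxima of the sharpened offsets against the full sums -/
theorem D_add_le (hA : AdmM M F) : ∀ (H : List (ℕ × ℕ × ℕ)), (∀ t ∈ H, t ∈ F) →
    (stOf M H).Dab + sumP F ≤ M ∧ (stOf M H).Dbc + sumQ F ≤ M ∧ (stOf M H).Dca + sumR F ≤ M
  | [], _ => by
    obtain ⟨-, ⟨hP, hQ, hR⟩, -, -⟩ := hA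
    simp [emptySt, hP, hQ, hR]
  | t :: H, hH => by
    obtain ⟨ihP, ihQ, ihR⟩ := D_add_le hA H (fun t' h => hH t' (List.mem_cons_of_mem _ h))
    obtain ⟨hP, hQ, hR⟩ := dab_add_le hA (hH t (List.mem_cons_self))
    simp only [stOf_cons, upd]
    refine ⟨?_, ?_, ?_⟩ <;> omega

/-- the running minima of the sizes against the full U11 sums -/
theorem min_bounds (hA : AdmM M F) : ∀ (H : List (ℕ × ℕ × ℕ)), (∀ t ∈ H, t ∈ F) →
    sumP F + sumR F ≤ M + (stOf M H).mA ∧ sumP F + sumQ F ≤ M + (stOf M H).mB ∧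
      sumQ F + sumR F ≤ M + (stOf M H).mC
  | [], _ => by
    obtain ⟨-, ⟨hP, hQ, hR⟩, -, -⟩ := hA
    simp [emptySt]; omega
  | t :: H, hH => by
    obtain ⟨ihA, ihB, ihC⟩ := min_bounds hA H (fun t' h => hH t' (List.mem_cons_of_mem _ h))
    obtain ⟨-, -, h11, -⟩ := hA
    obtain ⟨hta, htb, htc⟩ := h11 t (hH t (List.mem_cons_self))
    simp only [stOf_cons, upd, mkRec]
    refine ⟨?_, ?_, ?_⟩ <;> omega

/-- Members of a sub-family are members of the family. -/
theorem mem_of_coe_le {H : List (ℕ × ℕ × ℕ)} (hH : (H : Multiset (ℕ × ℕ × ℕ)) ≤ F) :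
    ∀ t ∈ H, t ∈ F := fun t ht => Multiset.mem_of_le hH (by simpa using ht)

/-- The pair-product sums of a sub-family are bounded by those of the family. -/
theorem sums_le {H : List (ℕ × ℕ × ℕ)} (hH : (H : Multiset (ℕ × ℕ × ℕ)) ≤ F) :
    (stOf M H).P ≤ sumP F ∧ (stOf M H).Q ≤ sumQ F ∧ (stOf M H).R ≤ sumR F := by
  rw [decomp hH, sumP_add, sumQ_add, sumR_add, sumP_coe, sumQ_coe, sumR_coe, stOf_P, stOf_Q, stOf_R]
  refine ⟨?_, ?_, ?_⟩ <;> omega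

/-- The node filter accepts every genuine sub-family. -/
theorem okSt_stOf (hA : AdmM M F) {H : List (ℕ × ℕ × ℕ)} (hH : (H : Multiset (ℕ × ℕ × ℕ)) ≤ F) :
    okSt M (stOf M H) = true := by
  obtain ⟨hP, hQ, hR⟩ := sums_le (M := M) hH
  obtain ⟨hDa, hDb, hDc⟩ := D_add_le hA H (mem_of_coe_le hH)
  obtain ⟨hmA, hmB, hmC⟩ := min_bounds hA H (mem_of_coe_le hH)
  obtain ⟨-, ⟨hPF, hQF, hRF⟩, -, -⟩ := hA
  generalize stOf M H = st at *
  have e1 : st.P - M = 0 := Nat.sub_eq_zero_of_le (by omega)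
  have e2 : st.Q - M = 0 := Nat.sub_eq_zero_of_le (by omega)
  have e3 : st.R - M = 0 := Nat.sub_eq_zero_of_le (by omega)
  have e4 : st.P + st.R - (M + st.mA) = 0 := Nat.sub_eq_zero_of_le (by omega)
  have e5 : st.P + st.Q - (M + st.mB) = 0 := Nat.sub_eq_zero_of_le (by omega)
  have e6 : st.Q + st.R - (M + st.mC) = 0 := Nat.sub_eq_zero_of_le (by omega)
  have e7 : st.Dab + st.P - M = 0 := Nat.sub_eq_zero_of_le (by omega)
  have e8 : st.Dbc + st.Q - M = 0 := Nat.sub_eq_zero_of_le (by omega)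
  have e9 : st.Dca + st.R - M = 0 := Nat.sub_eq_zero_of_le (by omega)
  simp only [okSt, e1, e2, e3, e4, e5, e6, e7, e8, e9]
  rfl

/-- cons of a remaining member onto a sub-family stays a sub-family -/
theorem cons_le {H : List (ℕ × ℕ × ℕ)} (hH : (H : Multiset (ℕ × ℕ × ℕ)) ≤ F) {t : ℕ × ℕ × ℕ}
    (ht : t ∈ F - (H : Multiset (ℕ × ℕ × ℕ))) : ((t :: H : List (ℕ × ℕ × ℕ)) : Multiset (ℕ × ℕ × ℕ)) ≤ F := by
  rw [← Multiset.cons_coe, ← Multiset.singleton_add]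
  calc {t} + (H : Multiset (ℕ × ℕ × ℕ)) ≤ (F - (H : Multiset (ℕ × ℕ × ℕ))) + (H : Multiset (ℕ × ℕ × ℕ)) :=
        add_le_add (Multiset.singleton_le.mpr ht) le_rfl
    _ = F := tsub_add_cancel_of_le hH

/-- A remaining member's volume is eligible. -/
theorem eligible_of_mem (hA : AdmM M F) {H : List (ℕ × ℕ × ℕ)} (hH : (H : Multiset (ℕ × ℕ × ℕ)) ≤ F)
    {t : ℕ × ℕ × ℕ} (ht : t ∈ F - (H : Multiset (ℕ × ℕ × ℕ))) : eligible M (stOf M H) (vol t) = true := by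
  have hle := cons_le hH ht
  obtain ⟨hP, hQ, hR⟩ := sums_le (M := M) hle
  simp only [stOf_cons, upd, mkRec] at hP hQ hR
  obtain ⟨-, -, -, h14⟩ := hA
  obtain ⟨⟨hab, -⟩, ⟨hbc, -⟩, ⟨hca, -⟩⟩ := h14 t (Multiset.mem_of_le tsub_le_self ht)
  simp only [eligible, Nat.beq_eq, uu, vv, ww] at *
  omega

/-- The completion budget bounds the total weight of the remaining members. -/
theorem weight_le_budget (hA : AdmM M F) {H : List (ℕ × ℕ × ℕ)} (hH : (H : Multiset (ℕ × ℕ × ℕ)) ≤ F) :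
    ((F - (H : Multiset (ℕ × ℕ × ℕ))).map us).sum ≤ budget M (stOf M H) := by
  have hw : ((F - (H : Multiset (ℕ × ℕ × ℕ))).map us).sum = sumP (F - (H : Multiset (ℕ × ℕ × ℕ))) + sumQ (F - (H : Multiset (ℕ × ℕ × ℕ))) + sumR (F - (H : Multiset (ℕ × ℕ × ℕ))) := by
    simp only [sumP, sumQ, sumR, us, Multiset.sum_map_add]
  obtain ⟨hDa, hDb, hDc⟩ := D_add_le hA H (mem_of_coe_le hH)
  obtain ⟨hmA, hmB, hmC⟩ := min_bounds hA H (mem_of_coe_le hH)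
  have eP : sumP F = (stOf M H).P + sumP (F - (H : Multiset (ℕ × ℕ × ℕ))) := by
    conv_lhs => rw [decomp hH]
    rw [sumP_add, sumP_coe, stOf_P]
  have eQ : sumQ F = (stOf M H).Q + sumQ (F - (H : Multiset (ℕ × ℕ × ℕ))) := by
    conv_lhs => rw [decomp hH]
    rw [sumQ_add, sumQ_coe, stOf_Q]
  have eR : sumR F = (stOf M H).R + sumR (F - (H : Multiset (ℕ × ℕ × ℕ))) := by
    conv_lhs => rw [decomp hH]
    rw [sumR_add, sumR_coe, stOf_R]
  rw [hw]
  simp only [budget]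
  omega

/-- value decomposition -/
theorem sumVal_split {H : List (ℕ × ℕ × ℕ)} (hH : (H : Multiset (ℕ × ℕ × ℕ)) ≤ F) :
    sumVal F = (stOf M H).sq + sumVal (F - (H : Multiset (ℕ × ℕ × ℕ))) := by
  conv_lhs => rw [decomp hH]
  rw [sumVal_add, sumVal_coe, stOf_sq]

/-- Cardinality decomposition along a sub-family. -/
theorem card_split {H : List (ℕ × ℕ × ℕ)} (hH : (H : Multiset (ℕ × ℕ × ℕ)) ≤ F) :
    Multiset.card F = H.length + Multiset.card (F - (H : Multiset (ℕ × ℕ × ℕ))) := by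
  conv_lhs => rw [decomp hH]
  simp

end AdmLemmas

/-! ## The break test and the residual test -/

section Tests

variable {M : ℕ} {F : Multiset (ℕ × ℕ × ℕ)}

/-- A dominating row of full length refutes «beats» once the break test fires. -/
theorem not_break (hA : AdmM M F) (hbeat : K * M < sumVal F) {H : List (ℕ × ℕ × ℕ)}
    (hH : (H : Multiset (ℕ × ℕ × ℕ)) ≤ F) {row : List ℕ} {C : ℕ × ℕ × ℕ → Prop} (hlen : row.length = Bmax + 1)
    (hdom : Dom row C) (hC : ∀ t ∈ F - (H : Multiset (ℕ × ℕ × ℕ)), C t) :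
    breakTest M (stOf M H) row = false := by
  by_contra hb
  rw [Bool.not_eq_false] at hb
  unfold breakTest at hb
  split at hb
  · rename_i x hx
    simp only [Nat.ble_eq] at hb
    obtain ⟨hlt, rfl⟩ := List.getElem?_eq_some_iff.mp hx
    have hbud : budget M (stOf M H) ≤ Bmax := by omega
    have e1 : ((F - (H : Multiset (ℕ × ℕ × ℕ))).map us).sum = ((F - (H : Multiset (ℕ × ℕ × ℕ))).toList.map us).sum := by
      conv_lhs => rw [← Multiset.coe_toList (F - (H : Multiset (ℕ × ℕ × ℕ)))]
      rw [Multiset.map_coe, Multiset.sum_coe]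
    have e2 : sumVal (F - (H : Multiset (ℕ × ℕ × ℕ))) = ((F - (H : Multiset (ℕ × ℕ × ℕ))).toList.map fun t => qOf (vol t)).sum := by
      conv_lhs => rw [← Multiset.coe_toList (F - (H : Multiset (ℕ × ℕ × ℕ)))]
      exact sumVal_coe _
    have hD := hdom (F - (H : Multiset (ℕ × ℕ × ℕ))).toList (fun t ht => hC t (Multiset.mem_toList.mp ht)) _ hbud
      (by rw [← e1]; exact weight_le_budget hA hH)
    have := sumVal_split (M := M) hH
    rw [List.getD_eq_getElem?_getD, List.getElem?_eq_getElem hlt, Option.getD_some] at hD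
    omega
  · exact absurd hb (by simp)

/-- `cnt` is the multiset count. -/
theorem cnt_eq_count (x : ℕ × ℕ × ℕ) : ∀ l : List (ℕ × ℕ × ℕ), cnt x l = Multiset.count x (l : Multiset _)
  | [] => by simp [cnt]
  | y :: l => by
    rw [cnt, cnt_eq_count x l, ← Multiset.cons_coe, Multiset.count_cons]
    by_cases h : y = x
    · subst h; simp
    · simp [h, Ne.symm h]

/-- `subCount` certifies a sub-multiset. -/
theorem coe_le_of_subCount {L H : List (ℕ × ℕ × ℕ)} (h : subCount L H = true) :
    (L : Multiset (ℕ × ℕ × ℕ)) ≤ H := by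
  rw [Multiset.le_iff_count]
  intro x
  simp only [subCount, List.all_eq_true, Nat.ble_eq, cnt_eq_count] at h
  by_cases hx : x ∈ L
  · exact h x hx
  · rw [Multiset.count_eq_zero_of_notMem (by simpa using hx)]; exact Nat.zero_le _

/-- The residual test certifies `ResidualM`. -/
theorem residual_of_resid {H : List (ℕ × ℕ × ℕ)} (hH : (H : Multiset (ℕ × ℕ × ℕ)) ≤ F)
    (h : resid M (stOf M H).fam = true) : ResidualM M F := by
  rw [stOf_fam] at h
  simp only [resid, List.any_eq_true] at h
  obtain ⟨L, hL, hsub⟩ := h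
  exact ⟨L, hL, (coe_le_of_subCount hsub).trans hH⟩

end Tests

end Summit.MatrixMultiplication.MatrixMultiplication.Theorems.TECert
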